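import Mathlib
import HarnessLib

/-!
# WeilTypeLadder · compact orderings of Weil-type `ℤ/6` rotation tuples — the hypothesis of THEOREM DISC-6, for ALL `N`

b2b cell `hweil` (packet `run/shared/lean/b2b/hodge-weil/`, report `b2b-hweil-pv3-g39/ORDERING-LEMMA.md`, prover 3
generation 39). PURE COMBINATORICS on `ℤ/6`, no geometry, no named fact, no `decide` census: an honest induction.

A cyclic `ℤ/6`-cover `C → ℙ¹` branched at `N` points with rotation numbers `β₁, …, β_N ∈ ℤ/6 ∖ {0}` has a
`ζ₆`-primitive Prym `B` of WEIL TYPE iff `Σᵢ ⟨βᵢ⟩ = 3N` (Schoen 1988 Cor. 1.9; in count-vector form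
`a + 2b + 3c + 4d + 5e = 3N`, `(a,b,c,d,e) = (#1, #2, #3, #4, #5)`; for a genuine cover `Σᵢ βᵢ = 0` in `ℤ/6`, i.e. `N` is
even). The packet's THEOREM DISC-6
([P3-g37] §3.6: `B` is split iff `c = #{βᵢ = 3}` is even) is proved there for every tuple admitting a COMPACT ORDERING —
an ordering `β₁, …, β_N` all of whose proper partial sums `β₁ + ⋯ + β_k` (`1 ≤ k ≤ N − 1`) are `≠ 0` in `ℤ/6` (then every
collision of the comb degeneration has finite local monodromy on the primitive part). [P3-g38] §5 verified by machine
that every CONNECTED Weil-type tuple with `N ≤ 24` has one and that the Weil hypothesis cannot be dropped (`1¹²`).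

This file PROVES, for all `N` (a list `l : List (ZMod 6)` is a compact ordering when
`∀ k < l.length, 0 < k → (l.take k).sum ≠ 0`):

* `cyclicSextic_weil_exists_compactOrdering` — every Weil-type count vector `(a,b,c,d,e)`, `N = a+b+c+d+e ≥ 2` even,
  OTHER THAN `(0,0,N,0,0)` with `N ≥ 4`, is the count vector of a compact ordering without the letter `0` (strong
  induction on `N`: remove `{3,3}`, `{1,5}`, `{2,4}` or a block `{1,1,4,4,4,4}` / `{5,5,2,2,2,2}` and re-insert it behind
  the first or second letter of a compact ordering of the rest — `compactOrdering_insert`; bases `{x,−x}`, `{3,3}`,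
  `{1,4,4,3}`, `{1,1,4,4,4,4}` and negatives);
* `cyclicSextic_allThree_not_compactOrdering` — the exception is real (`3 + 3 = 0`);
* `cyclicSextic_weil_compactOrdering_iff` — the two combined;
* `cyclicSextic_connectedWeil_exists_compactOrdering` — EVERY CONNECTED Weil-type tuple has a compact ordering: the
  hypothesis of THEOREM DISC-6 holds for all `N` (was: machine, `N ≤ 24`);
* `cyclicSextic_weil_perm_compactOrdering` — the same as a statement about RE-ORDERING a given list of rotation numbers.

HONEST LABEL: bookkeeping for the packet's THEOREM DISC-6 (which stays pen-and-paper); 0 rungs; nothing of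
Markman 2025 / Mostaed 2026 / Perry 2026 is used; no kit job.
-/

-- every declaration of this problem lives in `Summit.HodgeConjecture.HodgeConjecture.…` (summit = sub-problem)
set_option linter.dupNamespace false

namespace Summit.HodgeConjecture.HodgeConjecture.WeilTypeLadder

section CyclicSexticOrderings

/-- **Insertion.** If `P ++ R` (both non-empty) has all proper prefix sums non-zero, `B` sums to `0`, and the proper
prefix sums of `B` shifted by `P.sum` are non-zero, then `P ++ B ++ R` has all proper prefix sums non-zero
(the prefixes ending inside `P` or inside `R` have the old sums, because `B.sum = 0`). [folklore] -/
theorem compactOrdering_insert (P B R : List (ZMod 6))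
    (hg : ∀ k < (P ++ R).length, 0 < k → ((P ++ R).take k).sum ≠ 0)
    (hP : P ≠ []) (hR : R ≠ []) (hB : B.sum = 0)
    (hPB : ∀ j < B.length, 0 < j → P.sum + (B.take j).sum ≠ 0) :
    ∀ k < (P ++ B ++ R).length, 0 < k → ((P ++ B ++ R).take k).sum ≠ 0 := by
  intro k hkl hk
  have hPl : 0 < P.length := List.length_pos_iff.mpr hP
  have hRl : 0 < R.length := List.length_pos_iff.mpr hR
  simp only [List.append_assoc, List.length_append] at hkl hg ⊢
  rw [List.take_append, List.take_append, List.sum_append, List.sum_append]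
  by_cases h1 : k ≤ P.length
  · have e1 : k - P.length = 0 := by omega
    have h := hg k (by omega) hk
    rw [List.take_append, e1, List.take_zero, List.append_nil] at h
    simpa [e1] using h
  · push Not at h1
    rw [List.take_of_length_le (le_of_lt h1)]
    by_cases h2 : k < P.length + B.length
    · have e2 : k - P.length - B.length = 0 := by omega
      simp only [e2, List.take_zero, List.sum_nil, add_zero]
      exact hPB (k - P.length) (by omega) (by omega)
    · push Not at h2
      rw [List.take_of_length_le (show B.length ≤ k - P.length by omega), hB, zero_add]
      have h := hg (k - B.length) (by omega) (by omega)
      rw [List.take_append, List.take_of_length_le (show P.length ≤ k - B.length by omega), List.sum_append,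
        show k - B.length - P.length = k - P.length - B.length by omega] at h
      exact h

/-- The six residues mod `6`. [folklore] -/
theorem zmod6_eq_cases (x : ZMod 6) : x = 0 ∨ x = 1 ∨ x = 2 ∨ x = 3 ∨ x = 4 ∨ x = 5 := by
  revert x; decide

/-- For a list of residues mod `6`, the length is the sum of the six letter counts. [folklore] -/
theorem length_eq_sum_count_zmod6 (l : List (ZMod 6)) :
    l.length = l.count 0 + l.count 1 + l.count 2 + l.count 3 + l.count 4 + l.count 5 := by
  induction l with
  | nil => simp
  | cons x t ih =>
    rcases zmod6_eq_cases x with rfl | rfl | rfl | rfl | rfl | rfl <;>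
      simp (config := { decide := true }) [ih] <;> omega

/-- **The first letter of a compact ordering is non-zero** (it is the first proper prefix sum, when the list has at
least two letters). [folklore] -/
theorem compactOrdering_head_ne_zero (x : ZMod 6) (t : List (ZMod 6)) (ht : t ≠ [])
    (hg : ∀ k < (x :: t).length, 0 < k → ((x :: t).take k).sum ≠ 0) : x ≠ 0 := by
  have h := hg 1 (by simp [List.length_pos_iff.mpr ht]) Nat.one_pos
  simpa using h

/-- **Insertion behind the first letter.** A compact ordering `x :: y :: t` and a zero-sum block `B` whose proper
prefix sums avoid `−x` give the compact ordering `x :: (B ++ y :: t)`, with letter counts and lengths added.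
[folklore] -/
theorem compactOrdering_insert_one (x y : ZMod 6) (t B : List (ZMod 6))
    (hg : ∀ k < (x :: y :: t).length, 0 < k → ((x :: y :: t).take k).sum ≠ 0) (hB : B.sum = 0)
    (hPB : ∀ j < B.length, 0 < j → x + (B.take j).sum ≠ 0) :
    (∀ k < (x :: (B ++ y :: t)).length, 0 < k → ((x :: (B ++ y :: t)).take k).sum ≠ 0) ∧
      (∀ z, (x :: (B ++ y :: t)).count z = (x :: y :: t).count z + B.count z) ∧
      (x :: (B ++ y :: t)).length = (x :: y :: t).length + B.length := by
  refine ⟨?_, ?_, ?_⟩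
  · have h := compactOrdering_insert [x] B (y :: t) (by simpa using hg) (by simp) (by simp) hB (by simpa using hPB)
    simpa using h
  · intro z
    simp only [List.count_cons, List.count_append]
    omega
  · simp only [List.length_cons, List.length_append]
    omega

/-- **Insertion behind the second letter.** A compact ordering `x :: y :: t` with `t ≠ []` and a zero-sum block `B`
whose proper prefix sums avoid `−(x + y)` give the compact ordering `x :: y :: (B ++ t)`. [folklore] -/
theorem compactOrdering_insert_two (x y : ZMod 6) (t B : List (ZMod 6)) (ht : t ≠ [])
    (hg : ∀ k < (x :: y :: t).length, 0 < k → ((x :: y :: t).take k).sum ≠ 0) (hB : B.sum = 0)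
    (hPB : ∀ j < B.length, 0 < j → x + y + (B.take j).sum ≠ 0) :
    (∀ k < (x :: y :: (B ++ t)).length, 0 < k → ((x :: y :: (B ++ t)).take k).sum ≠ 0) ∧
      (∀ z, (x :: y :: (B ++ t)).count z = (x :: y :: t).count z + B.count z) ∧
      (x :: y :: (B ++ t)).length = (x :: y :: t).length + B.length := by
  refine ⟨?_, ?_, ?_⟩
  · have h := compactOrdering_insert [x, y] B t (by simpa using hg) (by simp) ht hB
      (by simpa [add_assoc] using hPB)
    simpa using h
  · intro z
    simp only [List.count_cons, List.count_append]
    omega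
  · simp only [List.length_cons, List.length_append]
    omega

/-- **THE ORDERING LEMMA (existence, all `N`).** Every Weil-type `ℤ/6` count vector `(a,b,c,d,e)`
(`a + 2b + 3c + 4d + 5e = 3N`, `N = a+b+c+d+e` even, `N ≥ 2`) other than `(0,0,N,0,0)` with `N ≥ 4` is the count vector
of a list `l` over `ℤ/6 ∖ {0}` all of whose proper prefix sums are non-zero — a COMPACT ORDERING in the sense of the
packet's THEOREM DISC-6 ([P3-g37] §3.6). Proof by strong induction on `N`: remove `{3,3}` (re-insert behind the first
letter `x` if `x ≠ 3`, else behind the second), else `{1,5}` or `{2,4}` (re-insert behind the first letter in the order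
that avoids `0`), else the vector is `(a,0,c,2a,0)` or `(0,2e,c,0,e)` with `c ≤ 1`: remove a block `{1,1,4,4,4,4}` resp.
`{5,5,2,2,2,2}` (re-insert behind the first letter in one of four orders), down to the bases `{x,−x}`, `{3,3}`,
`{1,4,4,3}`, `{1,1,4,4,4,4}`, `{5,2,2,3}`, `{5,5,2,2,2,2}`. [folklore] -/
theorem cyclicSextic_weil_exists_compactOrdering :
    ∀ N a b c d e : ℕ, a + b + c + d + e = N → a + 2 * b + 3 * c + 4 * d + 5 * e = 3 * N → Even N → 2 ≤ N →
      ¬ (a = 0 ∧ b = 0 ∧ d = 0 ∧ e = 0 ∧ 4 ≤ c) →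
      ∃ l : List (ZMod 6), l.length = N ∧ l.count 0 = 0 ∧ l.count 1 = a ∧ l.count 2 = b ∧ l.count 3 = c ∧
        l.count 4 = d ∧ l.count 5 = e ∧ ∀ k < l.length, 0 < k → (l.take k).sum ≠ 0 := by
  intro N
  induction N using Nat.strong_induction_on with
  | _ N ih =>
  intro a b c d e hN hW hE h2 h3
  obtain ⟨r, hr⟩ := hE
  have hW' : 2 * a + b = d + 2 * e := by omega
  -- `2a + b = d + 2e` rules out exactly one letter different from `3` (an integrality fact `omega` needs help with)
  have hsum : a + b + d + e = 0 ∨ 2 ≤ a + b + d + e := by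
    rcases d with _ | d <;> rcases e with _ | e <;> omega
  by_cases hz : a + b + d + e = 0
  · -- all letters are `3`: then `c = N = 2`
    have hc4 : c < 4 := by
      by_contra hc4
      exact h3 ⟨by omega, by omega, by omega, by omega, by omega⟩
    have hc2 : c = 2 := by omega
    obtain ⟨hBl, hB0, hB1, hB2, hB3, hB4, hB5, hBg⟩ : ([3, 3] : List (ZMod 6)).length = 2 ∧
        ([3, 3] : List (ZMod 6)).count 0 = 0 ∧ ([3, 3] : List (ZMod 6)).count 1 = 0 ∧
        ([3, 3] : List (ZMod 6)).count 2 = 0 ∧ ([3, 3] : List (ZMod 6)).count 3 = 2 ∧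
        ([3, 3] : List (ZMod 6)).count 4 = 0 ∧ ([3, 3] : List (ZMod 6)).count 5 = 0 ∧
        ∀ k < ([3, 3] : List (ZMod 6)).length, 0 < k → (([3, 3] : List (ZMod 6)).take k).sum ≠ 0 := by decide
    exact ⟨[3, 3], by omega, hB0, by omega, by omega, by omega, by omega, by omega, hBg⟩
  by_cases hc : 2 ≤ c
  · -- remove `{3,3}`
    have hN4 : 4 ≤ N := by omega
    obtain ⟨l, hl, h0, h1, h2', h3', h4, h5, hg⟩ := ih (N - 2) (by omega) a b (c - 2) d e (by omega) (by omega)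
      ⟨r - 1, by omega⟩ (by omega) (by omega)
    rcases l with _ | ⟨x, _ | ⟨y, t⟩⟩
    · simp at hl; omega
    · simp at hl; omega
    have hy0 : y ≠ 0 := by
      intro hy
      have : (0 : ZMod 6) ∈ x :: y :: t := by simp [hy]
      exact (List.count_eq_zero.mp h0) this
    obtain ⟨hBs, hBl, hB0, hB1, hB2, hB3, hB4, hB5⟩ : ([3, 3] : List (ZMod 6)).sum = 0 ∧
        ([3, 3] : List (ZMod 6)).length = 2 ∧
        ([3, 3] : List (ZMod 6)).count 0 = 0 ∧ ([3, 3] : List (ZMod 6)).count 1 = 0 ∧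
        ([3, 3] : List (ZMod 6)).count 2 = 0 ∧ ([3, 3] : List (ZMod 6)).count 3 = 2 ∧
        ([3, 3] : List (ZMod 6)).count 4 = 0 ∧ ([3, 3] : List (ZMod 6)).count 5 = 0 := by decide
    by_cases hx3 : x = 3
    · subst hx3
      have ht : t ≠ [] := by
        intro ht
        subst ht
        have h3pos : 0 < ((3 : ZMod 6) :: y :: ([] : List (ZMod 6))).count 3 := List.count_pos_iff.mpr (by simp)
        simp at hl
        omega
      have key : ∀ y : ZMod 6, y ≠ 0 → ∀ j < ([3, 3] : List (ZMod 6)).length, 0 < j →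
          (3 : ZMod 6) + y + (([3, 3] : List (ZMod 6)).take j).sum ≠ 0 := by decide
      obtain ⟨hg1, hcount, hlen⟩ := compactOrdering_insert_two 3 y t [3, 3] ht hg hBs (key y hy0)
      refine ⟨3 :: y :: ([3, 3] ++ t), by rw [hlen, hl, hBl]; omega, ?_, ?_, ?_, ?_, ?_, ?_, hg1⟩
      all_goals rw [hcount]; omega
    · have key : ∀ x : ZMod 6, x ≠ 3 → ∀ j < ([3, 3] : List (ZMod 6)).length, 0 < j →
          x + (([3, 3] : List (ZMod 6)).take j).sum ≠ 0 := by decide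
      obtain ⟨hg1, hcount, hlen⟩ := compactOrdering_insert_one x y t [3, 3] hg hBs (key x hx3)
      refine ⟨x :: ([3, 3] ++ y :: t), by rw [hlen, hl, hBl]; omega, ?_, ?_, ?_, ?_, ?_, ?_, hg1⟩
      all_goals rw [hcount]; omega
  have hc1 : c ≤ 1 := by omega
  have hs2 : 2 ≤ a + b + d + e := by omega
  by_cases hae : 0 < a ∧ 0 < e
  · -- remove `{1,5}`
    by_cases hN2 : N = 2
    · obtain ⟨hBl, hB0, hB1, hB2, hB3, hB4, hB5, hBg⟩ : ([1, 5] : List (ZMod 6)).length = 2 ∧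
          ([1, 5] : List (ZMod 6)).count 0 = 0 ∧ ([1, 5] : List (ZMod 6)).count 1 = 1 ∧
          ([1, 5] : List (ZMod 6)).count 2 = 0 ∧ ([1, 5] : List (ZMod 6)).count 3 = 0 ∧
          ([1, 5] : List (ZMod 6)).count 4 = 0 ∧ ([1, 5] : List (ZMod 6)).count 5 = 1 ∧
          ∀ k < ([1, 5] : List (ZMod 6)).length, 0 < k → (([1, 5] : List (ZMod 6)).take k).sum ≠ 0 := by decide
      exact ⟨[1, 5], by omega, hB0, by omega, by omega, by omega, by omega, by omega, hBg⟩
    obtain ⟨l, hl, h0, h1, h2', h3', h4, h5, hg⟩ := ih (N - 2) (by omega) (a - 1) b c d (e - 1) (by omega)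
      (by omega) ⟨r - 1, by omega⟩ (by omega) (by omega)
    rcases l with _ | ⟨x, _ | ⟨y, t⟩⟩
    · simp at hl; omega
    · simp at hl; omega
    have hx0 : x ≠ 0 := compactOrdering_head_ne_zero x (y :: t) (by simp) hg
    have key : ∀ x : ZMod 6, x ≠ 0 → ∃ B ∈ [([1, 5] : List (ZMod 6)), [5, 1]],
        ∀ j < B.length, 0 < j → x + (B.take j).sum ≠ 0 := by decide
    obtain ⟨B, hBmem, hPB⟩ := key x hx0
    obtain ⟨hBs, hBl, hB0, hB1, hB2, hB3, hB4, hB5⟩ : B.sum = 0 ∧ B.length = 2 ∧ B.count 0 = 0 ∧ B.count 1 = 1 ∧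
        B.count 2 = 0 ∧ B.count 3 = 0 ∧ B.count 4 = 0 ∧ B.count 5 = 1 := by
      simp only [List.mem_cons, List.mem_nil_iff, or_false] at hBmem
      rcases hBmem with rfl | rfl <;> decide
    obtain ⟨hg1, hcount, hlen⟩ := compactOrdering_insert_one x y t B hg hBs hPB
    refine ⟨x :: (B ++ y :: t), by rw [hlen, hl, hBl]; omega, ?_, ?_, ?_, ?_, ?_, ?_, hg1⟩
    all_goals rw [hcount]; omega
  by_cases hbd : 0 < b ∧ 0 < d
  · -- remove `{2,4}`
    by_cases hN2 : N = 2
    · obtain ⟨hBl, hB0, hB1, hB2, hB3, hB4, hB5, hBg⟩ : ([2, 4] : List (ZMod 6)).length = 2 ∧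
          ([2, 4] : List (ZMod 6)).count 0 = 0 ∧ ([2, 4] : List (ZMod 6)).count 1 = 0 ∧
          ([2, 4] : List (ZMod 6)).count 2 = 1 ∧ ([2, 4] : List (ZMod 6)).count 3 = 0 ∧
          ([2, 4] : List (ZMod 6)).count 4 = 1 ∧ ([2, 4] : List (ZMod 6)).count 5 = 0 ∧
          ∀ k < ([2, 4] : List (ZMod 6)).length, 0 < k → (([2, 4] : List (ZMod 6)).take k).sum ≠ 0 := by decide
      exact ⟨[2, 4], by omega, hB0, by omega, by omega, by omega, by omega, by omega, hBg⟩
    obtain ⟨l, hl, h0, h1, h2', h3', h4, h5, hg⟩ := ih (N - 2) (by omega) a (b - 1) c (d - 1) e (by omega)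
      (by omega) ⟨r - 1, by omega⟩ (by omega) (by omega)
    rcases l with _ | ⟨x, _ | ⟨y, t⟩⟩
    · simp at hl; omega
    · simp at hl; omega
    have hx0 : x ≠ 0 := compactOrdering_head_ne_zero x (y :: t) (by simp) hg
    have key : ∀ x : ZMod 6, x ≠ 0 → ∃ B ∈ [([2, 4] : List (ZMod 6)), [4, 2]],
        ∀ j < B.length, 0 < j → x + (B.take j).sum ≠ 0 := by decide
    obtain ⟨B, hBmem, hPB⟩ := key x hx0
    obtain ⟨hBs, hBl, hB0, hB1, hB2, hB3, hB4, hB5⟩ : B.sum = 0 ∧ B.length = 2 ∧ B.count 0 = 0 ∧ B.count 1 = 0 ∧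
        B.count 2 = 1 ∧ B.count 3 = 0 ∧ B.count 4 = 1 ∧ B.count 5 = 0 := by
      simp only [List.mem_cons, List.mem_nil_iff, or_false] at hBmem
      rcases hBmem with rfl | rfl <;> decide
    obtain ⟨hg1, hcount, hlen⟩ := compactOrdering_insert_one x y t B hg hBs hPB
    refine ⟨x :: (B ++ y :: t), by rw [hlen, hl, hBl]; omega, ?_, ?_, ?_, ?_, ?_, ?_, hg1⟩
    all_goals rw [hcount]; omega
  -- irreducible: `(a, 0, c, 2a, 0)` or `(0, 2e, c, 0, e)` with `c ≤ 1`
  push Not at hae hbd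
  by_cases ha : 0 < a
  · have he : e = 0 := by have := hae ha; omega
    have hb : b = 0 := by
      rcases Nat.eq_zero_or_pos b with hb | hb
      · exact hb
      · have := hbd hb; omega
    have hd : d = 2 * a := by omega
    by_cases ha1 : a = 1
    · obtain ⟨hBl, hB0, hB1, hB2, hB3, hB4, hB5, hBg⟩ : ([1, 4, 4, 3] : List (ZMod 6)).length = 4 ∧
          ([1, 4, 4, 3] : List (ZMod 6)).count 0 = 0 ∧ ([1, 4, 4, 3] : List (ZMod 6)).count 1 = 1 ∧
          ([1, 4, 4, 3] : List (ZMod 6)).count 2 = 0 ∧ ([1, 4, 4, 3] : List (ZMod 6)).count 3 = 1 ∧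
          ([1, 4, 4, 3] : List (ZMod 6)).count 4 = 2 ∧ ([1, 4, 4, 3] : List (ZMod 6)).count 5 = 0 ∧
          ∀ k < ([1, 4, 4, 3] : List (ZMod 6)).length, 0 < k → (([1, 4, 4, 3] : List (ZMod 6)).take k).sum ≠ 0 := by
        decide
      exact ⟨[1, 4, 4, 3], by omega, hB0, by omega, by omega, by omega, by omega, by omega, hBg⟩
    by_cases ha2 : a = 2
    · obtain ⟨hBl, hB0, hB1, hB2, hB3, hB4, hB5, hBg⟩ : ([4, 4, 1, 1, 4, 4] : List (ZMod 6)).length = 6 ∧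
          ([4, 4, 1, 1, 4, 4] : List (ZMod 6)).count 0 = 0 ∧ ([4, 4, 1, 1, 4, 4] : List (ZMod 6)).count 1 = 2 ∧
          ([4, 4, 1, 1, 4, 4] : List (ZMod 6)).count 2 = 0 ∧ ([4, 4, 1, 1, 4, 4] : List (ZMod 6)).count 3 = 0 ∧
          ([4, 4, 1, 1, 4, 4] : List (ZMod 6)).count 4 = 4 ∧ ([4, 4, 1, 1, 4, 4] : List (ZMod 6)).count 5 = 0 ∧
          ∀ k < ([4, 4, 1, 1, 4, 4] : List (ZMod 6)).length, 0 < k →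
            (([4, 4, 1, 1, 4, 4] : List (ZMod 6)).take k).sum ≠ 0 := by
        decide
      exact ⟨[4, 4, 1, 1, 4, 4], by omega, hB0, by omega, by omega, by omega, by omega, by omega, hBg⟩
    -- `a ≥ 3`: remove `{1,1,4,4,4,4}`
    obtain ⟨l, hl, h0, h1, h2', h3', h4, h5, hg⟩ := ih (N - 6) (by omega) (a - 2) 0 c (d - 4) 0 (by omega)
      (by omega) ⟨r - 3, by omega⟩ (by omega) (by omega)
    rcases l with _ | ⟨x, _ | ⟨y, t⟩⟩
    · simp at hl; omega
    · simp at hl; omega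
    have hx0 : x ≠ 0 := compactOrdering_head_ne_zero x (y :: t) (by simp) hg
    have key : ∀ x : ZMod 6, x ≠ 0 →
        ∃ B ∈ [([1, 1, 4, 4, 4, 4] : List (ZMod 6)), [1, 4, 4, 4, 1, 4], [4, 1, 4, 4, 4, 1], [4, 4, 4, 4, 1, 1]],
        ∀ j < B.length, 0 < j → x + (B.take j).sum ≠ 0 := by decide
    obtain ⟨B, hBmem, hPB⟩ := key x hx0
    obtain ⟨hBs, hBl, hB0, hB1, hB2, hB3, hB4, hB5⟩ : B.sum = 0 ∧ B.length = 6 ∧ B.count 0 = 0 ∧ B.count 1 = 2 ∧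
        B.count 2 = 0 ∧ B.count 3 = 0 ∧ B.count 4 = 4 ∧ B.count 5 = 0 := by
      simp only [List.mem_cons, List.mem_nil_iff, or_false] at hBmem
      rcases hBmem with rfl | rfl | rfl | rfl <;> decide
    obtain ⟨hg1, hcount, hlen⟩ := compactOrdering_insert_one x y t B hg hBs hPB
    refine ⟨x :: (B ++ y :: t), by rw [hlen, hl, hBl]; omega, ?_, ?_, ?_, ?_, ?_, ?_, hg1⟩
    all_goals rw [hcount]; omega
  · have ha0 : a = 0 := by omega
    have hbpos : 0 < b := by omega
    have hd : d = 0 := by have := hbd hbpos; omega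
    have hb : b = 2 * e := by omega
    by_cases he1 : e = 1
    · obtain ⟨hBl, hB0, hB1, hB2, hB3, hB4, hB5, hBg⟩ : ([5, 2, 2, 3] : List (ZMod 6)).length = 4 ∧
          ([5, 2, 2, 3] : List (ZMod 6)).count 0 = 0 ∧ ([5, 2, 2, 3] : List (ZMod 6)).count 1 = 0 ∧
          ([5, 2, 2, 3] : List (ZMod 6)).count 2 = 2 ∧ ([5, 2, 2, 3] : List (ZMod 6)).count 3 = 1 ∧
          ([5, 2, 2, 3] : List (ZMod 6)).count 4 = 0 ∧ ([5, 2, 2, 3] : List (ZMod 6)).count 5 = 1 ∧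
          ∀ k < ([5, 2, 2, 3] : List (ZMod 6)).length, 0 < k → (([5, 2, 2, 3] : List (ZMod 6)).take k).sum ≠ 0 := by
        decide
      exact ⟨[5, 2, 2, 3], by omega, hB0, by omega, by omega, by omega, by omega, by omega, hBg⟩
    by_cases he2 : e = 2
    · obtain ⟨hBl, hB0, hB1, hB2, hB3, hB4, hB5, hBg⟩ : ([2, 2, 5, 5, 2, 2] : List (ZMod 6)).length = 6 ∧
          ([2, 2, 5, 5, 2, 2] : List (ZMod 6)).count 0 = 0 ∧ ([2, 2, 5, 5, 2, 2] : List (ZMod 6)).count 1 = 0 ∧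
          ([2, 2, 5, 5, 2, 2] : List (ZMod 6)).count 2 = 4 ∧ ([2, 2, 5, 5, 2, 2] : List (ZMod 6)).count 3 = 0 ∧
          ([2, 2, 5, 5, 2, 2] : List (ZMod 6)).count 4 = 0 ∧ ([2, 2, 5, 5, 2, 2] : List (ZMod 6)).count 5 = 2 ∧
          ∀ k < ([2, 2, 5, 5, 2, 2] : List (ZMod 6)).length, 0 < k →
            (([2, 2, 5, 5, 2, 2] : List (ZMod 6)).take k).sum ≠ 0 := by
        decide
      exact ⟨[2, 2, 5, 5, 2, 2], by omega, hB0, by omega, by omega, by omega, by omega, by omega, hBg⟩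
    -- `e ≥ 3`: remove `{5,5,2,2,2,2}`
    obtain ⟨l, hl, h0, h1, h2', h3', h4, h5, hg⟩ := ih (N - 6) (by omega) 0 (b - 4) c 0 (e - 2) (by omega)
      (by omega) ⟨r - 3, by omega⟩ (by omega) (by omega)
    rcases l with _ | ⟨x, _ | ⟨y, t⟩⟩
    · simp at hl; omega
    · simp at hl; omega
    have hx0 : x ≠ 0 := compactOrdering_head_ne_zero x (y :: t) (by simp) hg
    have key : ∀ x : ZMod 6, x ≠ 0 →
        ∃ B ∈ [([5, 5, 2, 2, 2, 2] : List (ZMod 6)), [5, 2, 2, 2, 5, 2], [2, 5, 2, 2, 2, 5], [2, 2, 2, 2, 5, 5]],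
        ∀ j < B.length, 0 < j → x + (B.take j).sum ≠ 0 := by decide
    obtain ⟨B, hBmem, hPB⟩ := key x hx0
    obtain ⟨hBs, hBl, hB0, hB1, hB2, hB3, hB4, hB5⟩ : B.sum = 0 ∧ B.length = 6 ∧ B.count 0 = 0 ∧ B.count 1 = 0 ∧
        B.count 2 = 4 ∧ B.count 3 = 0 ∧ B.count 4 = 0 ∧ B.count 5 = 2 := by
      simp only [List.mem_cons, List.mem_nil_iff, or_false] at hBmem
      rcases hBmem with rfl | rfl | rfl | rfl <;> decide
    obtain ⟨hg1, hcount, hlen⟩ := compactOrdering_insert_one x y t B hg hBs hPB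
    refine ⟨x :: (B ++ y :: t), by rw [hlen, hl, hBl]; omega, ?_, ?_, ?_, ?_, ?_, ?_, hg1⟩
    all_goals rw [hcount]; omega

/-- **The exception is real:** four or more rotation numbers all equal to `3` admit NO compact ordering (the second
partial sum is `3 + 3 = 0`). [folklore] -/
theorem cyclicSextic_allThree_not_compactOrdering (l : List (ZMod 6)) (h4 : 4 ≤ l.length) (h3 : ∀ x ∈ l, x = 3) :
    ¬ ∀ k < l.length, 0 < k → (l.take k).sum ≠ 0 := by
  intro hg
  rcases l with _ | ⟨x, _ | ⟨y, t⟩⟩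
  · simp at h4
  · simp at h4
  obtain ⟨rfl, rfl⟩ : x = 3 ∧ y = 3 := ⟨h3 x (by simp), h3 y (by simp)⟩
  have h := hg 2 (by simp at h4 ⊢; omega) (by omega)
  have htake : ((3 : ZMod 6) :: 3 :: t).take 2 = [3, 3] := rfl
  rw [htake] at h
  exact h (by decide)

/-- **THE ORDERING LEMMA (iff form).** For a Weil-type `ℤ/6` count vector `(a,b,c,d,e)` (`a + 2b + 3c + 4d + 5e = 3N`,
`N = a+b+c+d+e ≥ 2` even) there is a compact ordering with these letter counts iff the vector is not `(0,0,N,0,0)`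
with `N ≥ 4`. [folklore] -/
theorem cyclicSextic_weil_compactOrdering_iff (N a b c d e : ℕ) (hN : a + b + c + d + e = N)
    (hW : a + 2 * b + 3 * c + 4 * d + 5 * e = 3 * N) (hE : Even N) (h2 : 2 ≤ N) :
    (∃ l : List (ZMod 6), l.length = N ∧ l.count 0 = 0 ∧ l.count 1 = a ∧ l.count 2 = b ∧ l.count 3 = c ∧
        l.count 4 = d ∧ l.count 5 = e ∧ ∀ k < l.length, 0 < k → (l.take k).sum ≠ 0) ↔
      ¬ (a = 0 ∧ b = 0 ∧ d = 0 ∧ e = 0 ∧ 4 ≤ c) := by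
  refine ⟨?_, cyclicSextic_weil_exists_compactOrdering N a b c d e hN hW hE h2⟩
  rintro ⟨l, hl, h0, h1, h2', h3', h4, h5, hg⟩ ⟨rfl, rfl, rfl, rfl, hc⟩
  refine cyclicSextic_allThree_not_compactOrdering l (by omega) (fun x hx => ?_) hg
  have hpos := List.count_pos_iff.mpr hx
  rcases zmod6_eq_cases x with rfl | rfl | rfl | rfl | rfl | rfl <;> first | rfl | omega

/-- **COROLLARY (the hypothesis of THEOREM DISC-6, all `N`).** Every CONNECTED Weil-type `ℤ/6` rotation tuple over `ℙ¹`
— count vector `(a,b,c,d,e)` with `a + 2b + 3c + 4d + 5e = 3N`, `N` even (i.e. `Σ βᵢ ≡ 0 (mod 6)`: a genuine cover,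
unbranched at `∞`) and some rotation number prime to `3` (`0 < a + b + d + e`; only this half of the connectedness clause
`0 < a + c + e ∧ 0 < a + b + d + e` of `cyclicSextic_nonsimpleWeil_octuples` is needed) — admits a COMPACT ORDERING: an
ordering of its rotation numbers all of whose proper partial sums are non-zero in `ℤ/6`. Hence [P3-g37] THEOREM DISC-6
(`class(B) ≡ (−1)^{h/2}·2^{c}`: non-split iff `c` odd) holds for every `N`, not only `N ≤ 24`. [folklore] -/
theorem cyclicSextic_connectedWeil_exists_compactOrdering (N a b c d e : ℕ) (hN : a + b + c + d + e = N)
    (hW : a + 2 * b + 3 * c + 4 * d + 5 * e = 3 * N) (hE : Even N) (h3' : 0 < a + b + d + e) :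
    ∃ l : List (ZMod 6), l.length = N ∧ l.count 0 = 0 ∧ l.count 1 = a ∧ l.count 2 = b ∧ l.count 3 = c ∧
      l.count 4 = d ∧ l.count 5 = e ∧ ∀ k < l.length, 0 < k → (l.take k).sum ≠ 0 := by
  obtain ⟨r, hr⟩ := hE
  exact cyclicSextic_weil_exists_compactOrdering N a b c d e hN hW ⟨r, hr⟩ (by omega) (by omega)

/-- **THE ORDERING LEMMA (re-ordering form).** A list of rotation numbers in `ℤ/6 ∖ {0}` of Weil type
(`#1 + 2·#2 + 3·#3 + 4·#4 + 5·#5 = 3N`), of even length `N ≥ 2`, and not consisting of four or more letters `3`, can be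
RE-ORDERED (a permutation) so that all proper partial sums are non-zero. [folklore] -/
theorem cyclicSextic_weil_perm_compactOrdering (l : List (ZMod 6)) (h0 : (0 : ZMod 6) ∉ l)
    (hW : l.count 1 + 2 * l.count 2 + 3 * l.count 3 + 4 * l.count 4 + 5 * l.count 5 = 3 * l.length)
    (hE : Even l.length) (h2 : 2 ≤ l.length) (h3 : ¬ (4 ≤ l.length ∧ ∀ x ∈ l, x = 3)) :
    ∃ l' : List (ZMod 6), List.Perm l' l ∧ ∀ k < l'.length, 0 < k → (l'.take k).sum ≠ 0 := by
  have hc0 : l.count 0 = 0 := List.count_eq_zero.mpr h0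
  have hlen := length_eq_sum_count_zmod6 l
  have h3c : ¬ (l.count 1 = 0 ∧ l.count 2 = 0 ∧ l.count 4 = 0 ∧ l.count 5 = 0 ∧ 4 ≤ l.count 3) := by
    rintro ⟨h1, h2', h4, h5, hc⟩
    refine h3 ⟨by omega, fun x hx => ?_⟩
    have hpos := List.count_pos_iff.mpr hx
    rcases zmod6_eq_cases x with rfl | rfl | rfl | rfl | rfl | rfl <;> first | rfl | omega
  obtain ⟨l', hl', h0', h1', h2'', h3', h4', h5', hg'⟩ := cyclicSextic_weil_exists_compactOrdering l.length
    (l.count 1) (l.count 2) (l.count 3) (l.count 4) (l.count 5) (by omega) hW hE h2 h3c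
  refine ⟨l', List.perm_iff_count.mpr fun z => ?_, hg'⟩
  rcases zmod6_eq_cases z with rfl | rfl | rfl | rfl | rfl | rfl <;> omega

end CyclicSexticOrderings

end Summit.HodgeConjecture.HodgeConjecture.WeilTypeLadder
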